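import Literature.NumberTheory.Transcendental.KZSemiCanonicalReductionDimOne
import Mathlib.FieldTheory.AlgebraicClosure

/-!
# `RealOnePeriodRelations` (stmt-KontsevichZagierPeriods-10042), line `nash-retraction-thin-strip`
# (rational layer): stub `stub_ratReduce` — integrability removes the end-point poles

Let `K = algebraicClosure ℚ ℝ` be the field of real algebraic numbers and `P, Q ∈ K[X]` with `Q`
non-vanishing on the open interval `(0,1)`. If `f = P/Q` on `(0,1)` and `f` is integrable on
`(0,1)`, then `f = P₀/Q₀` on `(0,1)` for some `P₀, Q₀ ∈ K[X]` with `Q₀` non-vanishing on the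
CLOSED interval `[0,1]`.

Proof: induction on `deg Q`. If `P = 0`, take `P₀ = 0`, `Q₀ = 1`. Otherwise, if `Q` vanishes at
an end point `a ∈ {0, 1}`, then so does `P`: by `KZ.rootMultiplicity_le_of_integrableOn` (an
uncancelled zero of `Q` at `a` gives `|P/Q| ≥ c |t − a|⁻¹` near `a`, which is not integrable) the
root multiplicity of `Q` at `a` is at most that of `P`, in particular `P(a) = 0`; so
`P = (X − a) P₁`, `Q = (X − a) Q₁` in `K[X]`, `P/Q = P₁/Q₁` on `(0,1)` and `deg Q₁ < deg Q`. If `Q`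
vanishes at neither end point, `(P₀, Q₀) = (P, Q)` works.

References: J. Viu-Sos, *A semi-canonical reduction for periods of Kontsevich–Zagier*, Int. J.
Number Theory 17 (2021) 147–174, §2.3 (first paragraph); M. Kontsevich, D. Zagier, *Periods*
(2001), §1.1.
-/

noncomputable section

open scoped BigOperators Polynomial
open Set MeasureTheory Filter Topology
open Literature.NumberTheory.Transcendental

namespace Summit.KontsevichZagierPeriods.SymplecticScissors.RealOnePeriodRelations.RationalLayer

local notation3 (prettyPrint := false) "𝕂" => (↥(algebraicClosure ℚ ℝ))

/-- Evaluation of `Q ∈ K[X]` at the real number `0` is the image of `Q(0) ∈ K`. [folklore] -/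
private theorem aeval_zero_eq_algebraMap (Q : Polynomial 𝕂) :
    Polynomial.aeval (0 : ℝ) Q = algebraMap 𝕂 ℝ (Q.eval 0) := by
  rw [← Polynomial.aeval_algebraMap_apply_eq_algebraMap_eval, map_zero]

/-- Evaluation of `Q ∈ K[X]` at the real number `1` is the image of `Q(1) ∈ K`. [folklore] -/
private theorem aeval_one_eq_algebraMap (Q : Polynomial 𝕂) :
    Polynomial.aeval (1 : ℝ) Q = algebraMap 𝕂 ℝ (Q.eval 1) := by
  rw [← Polynomial.aeval_algebraMap_apply_eq_algebraMap_eval, map_one]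

/-- **One descent step.** If `P ≠ 0`, `Q ≠ 0` on `(0,1)`, `f = P/Q` on `(0,1)` is integrable on
`(0,1)` and `Q` has a root `a ∈ K` lying in `[0,1]`, then `P(a) = 0` as well (no integrable pole in
one variable, `KZ.rootMultiplicity_le_of_integrableOn`), and cancelling `X − a` writes `f = P₁/Q₁`
on `(0,1)` with `deg Q₁ < deg Q` and `Q₁ ≠ 0` on `(0,1)`. [cite: ViuSos2021, §2.3] -/
private theorem descend (f : ℝ → ℝ) (hf : IntegrableOn f (Ioo (0 : ℝ) 1)) (P Q : Polynomial 𝕂)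
    (hP : P ≠ 0) (hQ : ∀ t ∈ Ioo (0 : ℝ) 1, Polynomial.aeval t Q ≠ 0)
    (hfPQ : ∀ t ∈ Ioo (0 : ℝ) 1, f t = Polynomial.aeval t P / Polynomial.aeval t Q)
    (a : 𝕂) (ha : algebraMap 𝕂 ℝ a ∈ Icc (0 : ℝ) 1) (hQa : Q.IsRoot a) :
    ∃ P₁ Q₁ : Polynomial 𝕂, Q₁.natDegree < Q.natDegree ∧
      (∀ t ∈ Ioo (0 : ℝ) 1, Polynomial.aeval t Q₁ ≠ 0) ∧
      ∀ t ∈ Ioo (0 : ℝ) 1, f t = Polynomial.aeval t P₁ / Polynomial.aeval t Q₁ := by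
  have hQ0 : Q ≠ 0 := by
    rintro rfl
    exact hQ (1 / 2) ⟨by norm_num, by norm_num⟩ (map_zero _)
  have hinj : Function.Injective (algebraMap 𝕂 ℝ) := (algebraMap 𝕂 ℝ).injective
  -- the root multiplicities over `ℝ`: that of `Q` at `a` is positive and at most that of `P`
  have hP' : P.map (algebraMap 𝕂 ℝ) ≠ 0 := (Polynomial.map_ne_zero_iff hinj).mpr hP
  have hQ' : Q.map (algebraMap 𝕂 ℝ) ≠ 0 := (Polynomial.map_ne_zero_iff hinj).mpr hQ0
  have hint : IntegrableOn (fun t => (P.map (algebraMap 𝕂 ℝ)).eval t /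
      (Q.map (algebraMap 𝕂 ℝ)).eval t) (Ioo (0 : ℝ) 1) := by
    refine hf.congr_fun (fun t ht => ?_) measurableSet_Ioo
    simp only [Polynomial.eval_map_algebraMap]
    exact hfPQ t ht
  have hle := KZ.rootMultiplicity_le_of_integrableOn hP' hQ' zero_lt_one ha hint
  have hpos : 0 < (Q.map (algebraMap 𝕂 ℝ)).rootMultiplicity (algebraMap 𝕂 ℝ a) :=
    (Polynomial.rootMultiplicity_pos hQ').mpr hQa.map
  have hPa : P.IsRoot a :=
    ((Polynomial.rootMultiplicity_pos hP').mp (hpos.trans_le hle)).of_map hinj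
  -- cancel the common factor `X - C a`
  obtain ⟨P₁, hPfac⟩ : ∃ P₁, (Polynomial.X - Polynomial.C a) * P₁ = P :=
    ⟨_, Polynomial.mul_divByMonic_eq_iff_isRoot.mpr hPa⟩
  obtain ⟨Q₁, hQfac⟩ : ∃ Q₁, (Polynomial.X - Polynomial.C a) * Q₁ = Q :=
    ⟨_, Polynomial.mul_divByMonic_eq_iff_isRoot.mpr hQa⟩
  have hQ₁0 : Q₁ ≠ 0 := by
    rintro rfl
    rw [mul_zero] at hQfac
    exact hQ0 hQfac.symm
  have hdeg : Q₁.natDegree < Q.natDegree := by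
    rw [← hQfac, (Polynomial.monic_X_sub_C a).natDegree_mul' hQ₁0, Polynomial.natDegree_X_sub_C]
    omega
  have hQeval : ∀ t : ℝ,
      Polynomial.aeval t Q = (t - algebraMap 𝕂 ℝ a) * Polynomial.aeval t Q₁ := by
    intro t
    rw [← hQfac, map_mul, map_sub, Polynomial.aeval_X, Polynomial.aeval_C]
  have hPeval : ∀ t : ℝ,
      Polynomial.aeval t P = (t - algebraMap 𝕂 ℝ a) * Polynomial.aeval t P₁ := by
    intro t
    rw [← hPfac, map_mul, map_sub, Polynomial.aeval_X, Polynomial.aeval_C]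
  refine ⟨P₁, Q₁, hdeg, fun t ht h => hQ t ht (by rw [hQeval t, h, mul_zero]), fun t ht => ?_⟩
  have hta : t - algebraMap 𝕂 ℝ a ≠ 0 := fun h => hQ t ht (by rw [hQeval t, h, zero_mul])
  rw [hfPQ t ht, hPeval t, hQeval t, mul_div_mul_left _ _ hta]

/-- **The reduction**, by (strong) induction on `deg Q`: cancel the end-point roots of `Q` one at
a time with `descend`; when `Q(0) ≠ 0` and `Q(1) ≠ 0`, `Q` does not vanish on `[0,1]`.
[cite: ViuSos2021, §2.3] -/
private theorem reduce_aux (f : ℝ → ℝ) (hf : IntegrableOn f (Ioo (0 : ℝ) 1)) :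
    ∀ (n : ℕ) (P Q : Polynomial 𝕂), Q.natDegree = n →
      (∀ t ∈ Ioo (0 : ℝ) 1, Polynomial.aeval t Q ≠ 0) →
      (∀ t ∈ Ioo (0 : ℝ) 1, f t = Polynomial.aeval t P / Polynomial.aeval t Q) →
      ∃ P₀ Q₀ : Polynomial 𝕂,
        (∀ t ∈ Icc (0 : ℝ) 1, Polynomial.aeval t Q₀ ≠ 0) ∧
        ∀ t ∈ Ioo (0 : ℝ) 1, f t = Polynomial.aeval t P₀ / Polynomial.aeval t Q₀ := by
  intro n
  refine Nat.strong_induction_on n fun n ih => ?_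
  intro P Q hn hQ hfPQ
  have hinj : Function.Injective (algebraMap 𝕂 ℝ) := (algebraMap 𝕂 ℝ).injective
  by_cases hP : P = 0
  · refine ⟨0, 1, fun t _ => by simp, fun t ht => ?_⟩
    rw [hfPQ t ht, hP]
    simp
  by_cases hQ0 : Q.IsRoot 0
  · obtain ⟨P₁, Q₁, hdeg, hQ₁, hf₁⟩ :=
      descend f hf P Q hP hQ hfPQ 0 (by rw [map_zero]; exact ⟨le_rfl, zero_le_one⟩) hQ0
    exact ih Q₁.natDegree (hdeg.trans_eq hn) P₁ Q₁ rfl hQ₁ hf₁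
  by_cases hQ1 : Q.IsRoot 1
  · obtain ⟨P₁, Q₁, hdeg, hQ₁, hf₁⟩ :=
      descend f hf P Q hP hQ hfPQ 1 (by rw [map_one]; exact ⟨zero_le_one, le_rfl⟩) hQ1
    exact ih Q₁.natDegree (hdeg.trans_eq hn) P₁ Q₁ rfl hQ₁ hf₁
  refine ⟨P, Q, fun t ht => ?_, hfPQ⟩
  rcases eq_endpoints_or_mem_Ioo_of_mem_Icc ht with rfl | rfl | ht'
  · rw [aeval_zero_eq_algebraMap, map_ne_zero_iff _ hinj]
    exact hQ0
  · rw [aeval_one_eq_algebraMap, map_ne_zero_iff _ hinj]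
    exact hQ1
  · exact hQ t ht'

/-- **Integrability removes the end-point poles.** A quotient `P/Q` of polynomials with real
algebraic coefficients, denominator non-vanishing on `(0,1)`, which is integrable on `(0,1)`,
equals on `(0,1)` a quotient `P₀/Q₀` whose denominator does not vanish on the CLOSED interval
`[0,1]` (cancel the common factors `X`, `X − 1`; an uncancelled end-point zero of the denominator
gives `|f| ≥ c/|t − t₀|`, not integrable). [cite: ViuSos2021, §2.3] -/
theorem stub_ratReduce : ∀ (f : ℝ → ℝ) (P Q : Polynomial (algebraicClosure ℚ ℝ)),
    (∀ t ∈ Set.Ioo (0 : ℝ) 1, Polynomial.aeval t Q ≠ 0) →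
    (∀ t ∈ Set.Ioo (0 : ℝ) 1, f t = Polynomial.aeval t P / Polynomial.aeval t Q) →
    IntegrableOn f (Set.Ioo (0 : ℝ) 1) →
    ∃ P₀ Q₀ : Polynomial (algebraicClosure ℚ ℝ),
      (∀ t ∈ Set.Icc (0 : ℝ) 1, Polynomial.aeval t Q₀ ≠ 0) ∧
      ∀ t ∈ Set.Ioo (0 : ℝ) 1, f t = Polynomial.aeval t P₀ / Polynomial.aeval t Q₀ :=
  fun f P Q hQ hfPQ hf => reduce_aux f hf Q.natDegree P Q rfl hQ hfPQ

end Summit.KontsevichZagierPeriods.SymplecticScissors.RealOnePeriodRelations.RationalLayer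

end
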